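import Literature.Analysis.Asymptotics.MonomialUnitPhase
import Literature.Analysis.Asymptotics.PowerLogFiniteSum
import HarnessLib

/-!
# Power-log asymptotics from a decomposition into monomial chart pieces

The gluing step of the asymptotic theory of Laplace integrals / sublevel volumes with a
real-analytic phase (Arnold–Gusein-Zade–Varchenko II §7.3, proof of Thm. 7.5; Lin 2017, Lemma 2.4,
Prop. 2.5, Thm. 2.9), isolated from the resolution of singularities that produces the pieces:
**if** a function `V` agrees near `0⁺` with a finite non-empty sum of *monomial chart pieces*

  `∫_{a_i(x) x^{κ_i} ≤ t} ψ_i(x) ∏ x_j^{w_{ij}-1} dx`   over `(0,1]^d`,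

with exponents `κ_i ≠ 0`, natural weights `w_{ij} ≥ 1`, continuous units `a_i > 0` and continuous
amplitudes `ψ_i ≥ 0` on `[0,1]^d` that are positive at the origin (this is exactly what Hironaka's
theorem delivers after a partition of unity and the change of variables, cf. Lin, proof of
Lemma 2.4), **then** `V(t) / (t^λ (log 1/t)^{θ-1}) → C > 0` for a rational `λ > 0` and
`1 ≤ θ ≤ d` (`tendsto_of_monomialPieces`): `(λ, θ)` is the lexicographically dominant pair among
the `(rlct κ_i w_i, rlctMult κ_i w_i)`.

Everything is PROVED; no definitions, no named facts.

## References

* S. Lin, arXiv:1003.5338, Lemma 2.4, Prop. 2.5, Thm. 2.9. [Lin2017]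
* V. I. Arnold, S. M. Gusein-Zade, A. N. Varchenko, *Singularities of Differentiable Maps II*
  (2012), Part II §7.3, proof of Thm. 7.5. [ArnoldGuseinzadeVarchenko2012]
-/

noncomputable section

open MeasureTheory Filter Set Topology

namespace Literature.Analysis.Asymptotics.MonomialPhase

/-- The multiplicity is at most the dimension. [folklore] -/
theorem rlctMult_le {d : ℕ} (κ : Fin d → ℕ) (w : Fin d → ℝ) : rlctMult κ w ≤ d := by
  rw [rlctMult]
  exact (Finset.card_filter_le _ _).trans (by simp)

/-- For natural exponents and weights the real log-canonical threshold is a positive rational.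
[cite: Lin2017, Prop. 2.1] -/
theorem exists_rat_cast_eq_rlct {d : ℕ} (κ w : Fin d → ℕ) (hκ : κ ≠ 0) (hw : ∀ j, 0 < w j) :
    ∃ q : ℚ, 0 < q ∧ (q : ℝ) = rlct κ (fun j => (w j : ℝ)) := by
  obtain ⟨j, hj, hjeq⟩ := exists_rlct_eq (w := fun j => (w j : ℝ)) hκ
  refine ⟨(w j : ℚ) / (κ j : ℚ), div_pos (by exact_mod_cast hw j)
    (by exact_mod_cast Nat.pos_of_ne_zero hj), ?_⟩
  rw [hjeq]
  push_cast
  rfl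

/-- **Power-log asymptotics from monomial chart pieces** (the gluing step of AGV II §7.3 /
Lin 2017 Lemma 2.4–Thm. 2.9, with the resolution of singularities factored out): if near `0⁺`
`V(t) = ∑_i ∫_{a_i(x) x^{κ_i} ≤ t} ψ_i dvol_{w_i}` with `κ_i ≠ 0`, natural weights `w_i ≥ 1`,
continuous units `a_i > 0` and continuous amplitudes `ψ_i ≥ 0` on `[0,1]^d` with `ψ_i(0) > 0`
(a non-empty finite family), then `V(t)/(t^λ (log 1/t)^{θ-1}) → C` with `C > 0`, `λ ∈ ℚ_{>0}`,
`1 ≤ θ ≤ d`. [cite: Lin2017, Lemma 2.4, Prop. 2.5, Thm. 2.9]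
[cite: ArnoldGuseinzadeVarchenko2012, Part II §7.3 proof of Thm. 7.5] -/
theorem tendsto_of_monomialPieces {d : ℕ} {ι : Type*} [Fintype ι] [Nonempty ι]
    (κ w : ι → Fin d → ℕ) (a ψ : ι → (Fin d → ℝ) → ℝ)
    (hκ : ∀ i, κ i ≠ 0) (hw : ∀ i j, 0 < w i j)
    (ha : ∀ i, Continuous (a i)) (ha0 : ∀ i x, 0 < a i x)
    (hψ : ∀ i, Continuous (ψ i)) (hψ0 : ∀ i, ∀ x ∈ Icc (0 : Fin d → ℝ) 1, 0 ≤ ψ i x)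
    (hψpos : ∀ i, 0 < ψ i 0) {V : ℝ → ℝ} {t₀ : ℝ} (ht₀ : 0 < t₀)
    (hV : ∀ t, 0 < t → t < t₀ → V t = ∑ i, ∫ x in {x : Fin d → ℝ | a i x * ∏ j, x j ^ κ i j ≤ t},
      ψ i x ∂(Measure.pi fun j => powMeasure (w i j : ℝ))) :
    ∃ (C : ℝ) (lam : ℚ) (θ : ℕ), 0 < C ∧ 0 < lam ∧ 1 ≤ θ ∧ θ ≤ d ∧
      Tendsto (fun t : ℝ => V t / (t ^ (lam : ℝ) * Real.log t⁻¹ ^ (θ - 1))) (𝓝[>] 0) (𝓝 C) := by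
  have hw' : ∀ i j, (0 : ℝ) < (w i j : ℝ) := fun i j => by exact_mod_cast hw i j
  choose c hc hlim using fun i => exists_tendsto_unit_phase_pos (w := fun j => (w i j : ℝ))
    (hκ i) (hw' i) (ψ i) (a i) (hψ i) (hψ0 i) (hψpos i) (ha i) (ha0 i)
  obtain ⟨i₀, -, C, hC, -, -, hsum⟩ := tendsto_finset_sum_powerLog Finset.univ
    Finset.univ_nonempty
    (fun i t => ∫ x in {x : Fin d → ℝ | a i x * ∏ j, x j ^ κ i j ≤ t}, ψ i x
      ∂(Measure.pi fun j => powMeasure (w i j : ℝ)))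
    (fun i => rlct (κ i) fun j => (w i j : ℝ)) (fun i => rlctMult (κ i) fun j => (w i j : ℝ)) c
    (fun i _ => rlctMult_pos (hκ i)) (fun i _ => hc i) (fun i _ => hlim i)
  obtain ⟨q, hq, hqeq⟩ := exists_rat_cast_eq_rlct (κ i₀) (w i₀) (hκ i₀) (hw i₀)
  refine ⟨C, q, rlctMult (κ i₀) fun j => (w i₀ j : ℝ), hC, hq, rlctMult_pos (hκ i₀),
    rlctMult_le _ _, ?_⟩
  rw [hqeq]
  refine hsum.congr' ?_
  filter_upwards [Ioo_mem_nhdsGT ht₀] with t ht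
  rw [hV t ht.1 ht.2]

end Literature.Analysis.Asymptotics.MonomialPhase

end
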